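/-
Copyright (c) 2026 the pub-hodgecm-mathlib formalisation cell (harness21).  Prover seat hodgecm-mathlib-F0P3a-p01 (g15), 2026-09-01.  Road «S3-ram» (LEAD F0P3a-plan (g12)
T11-61; owner F0P3a-p06 (g15)): organ (e3) «LEVI-ram CLAUSE» in the currency of END's `stub_levelOneRowsRam` (fold v6 :118) — ★ core p846879 + ★ (O2″)-deep socket p846915 + ★ (O1″).
-/
import Literature.NumberTheory.Rogawski1990.DepthZeroKappaTransferLeviCoreRamified    -- ★ p846879 (this seat): the ramified Levi CORE over sockets `hX` ∕ `hΔ`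
import Literature.NumberTheory.Automorphic.TorusLevelDeepOrbitalIntegralSocket         -- ★ p846915 (this seat): `classOrbitalIntegral_eq_mul_of_level_frame_of_left_invariant` (place-generic `t`-removal)
import Literature.NumberTheory.Rogawski1990.LeviNearOneTwoDeep                          -- ★ p846644 (O1″): `exists_nhds_one_forall_levi_twoDeep`, `valued_lt_one_of_le_exp_neg_two`
import Literature.NumberTheory.Automorphic.RamifiedPlaceAntiFixedUniformizer            -- ★ `valued_toPlace_uniformizer_of_ramified`: `|ι_w ϖ_v|_w = exp(−2)` at a ramified `w`
import HarnessLib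

/-!
# The LEVI ROW of the depth-zero Δ‴-transfer at a TAME-RAMIFIED non-split place for a LEFT-`K(ϖ_v)`-INVARIANT `K`-class piece, modulo the C-Δram Levi value
# and the `N ∩ K₃`-integral (Rogawski (1990) §4.9 Prop. 4.9.1, §4.3 (4.3.1))

Topic `NumberTheory/Rogawski1990`; namespace `Literature.NumberTheory.Rogawski1990`.  KERNEL mathematics only: theorems, no definition, no named fact, no
instance, no notation, no `sorry`.  Cell `pub/hodgecm-mathlib`, crux H413 = `stmt-HodgeConjecture-24833`; road «S3-ram» (Literature seeding; LEAD F0P3a-plan (g12)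
T11-61, owner F0P3a-p06 (g15)), organ **(e3) «LEVI-ram CLAUSE» in the `v`-LEVEL-1 currency** of END's last socket `stub_levelOneRowsRam` (fold v6 :118: pieces
left-invariant under the congruence set `K(ϖ_v)`, token `hg1`).  Composition: ★ core p846879 with `deep :=` LEVEL-DEEP `|d_{i,w} − 1|_w ≤ |ϖ_v|_w` (near `1` by ★ (O1″)
`exists_nhds_one_forall_levi_twoDeep` and `|ι_w ϖ_v|_w = exp(−2)` ★ `valued_toPlace_uniformizer_of_ramified`), `hX :=` ★ p846915
`classOrbitalIntegral_eq_mul_of_level_frame_of_left_invariant` (the `t`-removal: `g(ψ⁻¹(tn)) = g(ψ⁻¹ n)`); what remains are TWO scalar sockets — the C-Δ Levi value `hΔ`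
(p07 (g12), T11-60 (3)) and the `N ∩ K₃`-integral `hN : ∫_N g(ψ⁻¹ n) dμ_N = μ_N(N ∩ K₃)·X` through every integral level frame (the ONLY entrance of the `𝔭`-layer
strata; L1 hands F0P3-p02 (g16) ∕ F0P2-p01 (g14)).  HONEST LABEL: HC_CM is proved only modulo the cell's 2 remaining named inputs (hLiu418 24832, h413 24833) until
rung 0 closes; «S3-ram» has no books consequence; this file is unconditional and discharges nothing by itself.

THE STATEMENT.  For such a piece `g` (Borel, `Ad K′`-invariant, left-`K(ϖ_v)`-invariant) and scalars `X` (`hN`), `ε` (`hΔ`): the two-row identity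
`Σᶠ_c Δ‴_v(γ_H, c)·Φ(c, g) = a₀·Φ^st(γ_H, χ₀) + a₁·Φ^st(γ_H, χ₁)` holds for `G`-regular LEVI `γ_H` near `1` whenever **`a₀·ν_H(K_H) = ε·ν_G(K′)·X`** (`a₁` free).

## References
* [Rogawski1990] J. D. Rogawski, *Automorphic Representations of Unitary Groups in Three Variables*, Ann. of Math. Stud. 123 (1990), §4.9 Prop. 4.9.1 (a)(b), (4.9.2) pp. 54–56;
  §4.3 (4.3.1) p. 43.
* [LanglandsShelstad1987] R. P. Langlands, D. Shelstad, *On the definition of transfer factors*, Math. Ann. 278 (1987), §1.3–1.4.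
* [Kottwitz1986] R. E. Kottwitz, *Base change for unit elements of Hecke algebras*, Compositio Math. 60 (1986), §3, §7.
-/

set_option autoImplicit false

noncomputable section

open NumberField IsDedekindDomain MeasureTheory Measure Topology Filter Matrix
open Literature.NumberTheory.Automorphic Literature.NumberTheory.Automorphic.UnitaryGroup Literature.NumberTheory.Automorphic.IntegralReduction
open Literature.NumberTheory.GaloisRepresentations
open scoped Matrix MatrixGroups NNReal ENNReal ValuativeRel

namespace Literature.NumberTheory.Rogawski1990

set_option maxHeartbeats 1600000 in
-- instance-term unification on the CM local carriers (as in ★ p846879)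
open scoped Classical in
/-- **THE LEVI ROW OF THE Δ‴-TRANSFER AT A TAME-RAMIFIED PLACE FOR A LEFT-`K(ϖ_v)`-INVARIANT `K`-CLASS PIECE, MODULO THE C-Δ LEVI VALUE AND THE
`N ∩ K₃`-INTEGRAL** (organ (e3), `stub_levelOneRowsRam` currency): ★ core p846879 with `deep :=` level-deep and `hX :=` ★ p846915; sockets `hN` (the `N ∩ K₃`-integral
of `g∘ψ⁻¹` through every integral level frame, `= μ_N(N ∩ K₃)·X`) and `hΔ` (C-Δ Levi value `ε·‖a − 1‖` near `1`); test `a₀·ν_H(K_H) = ε·ν_G(K′)·X`, `a₁` free.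
[cite: Rogawski1990, §4.9 Prop. 4.9.1 (a)(b) pp. 54–56; §4.3 (4.3.1) p. 43] [cite: LanglandsShelstad1987, §1.3–1.4] [cite: Kottwitz1986, §3] -/
theorem finsum_delta_mul_classOrbitalIntegral_eq_of_levi_ramified_levelOne_of_delta_eq
    (L : Type) [Field L] [NumberField L] [IsCMField L] (H' : Matrix (Fin 3) (Fin 3) L) (μ : HeckeCharacter L)
    {v : HeightOneSpectrum (𝓞 ↥(maximalRealSubfield L))}
    (hH' : (H'.map (cmConjRingHom L)).transpose = H') (w : PlacesOver L v)
    (hw : IsCMField.complexConj L • w.1 = w.1) (he : v.asIdeal.ramificationIdx' w.1.asIdeal ≠ 1)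
    -- good reduction (`_hH'i` idle: the frame binder `hframe`∕`hA` below carries the integrality; kept so the binder list is END's socket frame)
    (hH'w : IsUnit (placeForm H' w.1)) (_hH'i : hH'w.unit ∈ glInt 3 (w.1.adicCompletion L))
    (h2 : IsUnit (2 : 𝒪[w.1.adicCompletion L]))
    -- the integral antidiagonal FRAME of `H′_w` (END fold v2 socket binders; supplied at a tame-ramified `w` by ★ p846344 `exists_glInt_placeForm_eq_smul_formCongr_antidiagonal_of_neg`)
    (A : GL (Fin 3) (w.1.adicCompletion L)) (hA : A ∈ glInt 3 (w.1.adicCompletion L))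
    (hframe : placeForm H' w.1 = (-(placeForm H' w.1).det) • formCongr (galAdicCompletionMap (L := L) (IsCMField.complexConj L) hw) A ((StdForm.antidiagonal 3).over (w.1.adicCompletion L)))
    [MeasurableSpace ((cmDatum L 3 H').Local v)] [BorelSpace ((cmDatum L 3 H').Local v)]
    [∀ γ : ((cmDatum L 3 H').Local v), MeasurableSpace (((cmDatum L 3 H').Local v) ⧸ Subgroup.centralizer ({γ} : Set ((cmDatum L 3 H').Local v)))]
    [∀ γ : ((cmDatum L 3 H').Local v), BorelSpace (((cmDatum L 3 H').Local v) ⧸ Subgroup.centralizer ({γ} : Set ((cmDatum L 3 H').Local v)))]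
    [MeasurableSpace ((cmDatum L 2 (Matrix.of fun i j : Fin 2 => if i.val + j.val + 1 = 2 then (1 : L) else 0)).Local v ×
      (cmDatum L 1 (Matrix.of fun i j : Fin 1 => if i.val + j.val + 1 = 1 then (1 : L) else 0)).Local v)]
    [BorelSpace ((cmDatum L 2 (Matrix.of fun i j : Fin 2 => if i.val + j.val + 1 = 2 then (1 : L) else 0)).Local v ×
      (cmDatum L 1 (Matrix.of fun i j : Fin 1 => if i.val + j.val + 1 = 1 then (1 : L) else 0)).Local v)]
    [∀ a : ((cmDatum L 2 (Matrix.of fun i j : Fin 2 => if i.val + j.val + 1 = 2 then (1 : L) else 0)).Local v ×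
      (cmDatum L 1 (Matrix.of fun i j : Fin 1 => if i.val + j.val + 1 = 1 then (1 : L) else 0)).Local v),
      MeasurableSpace (((cmDatum L 2 (Matrix.of fun i j : Fin 2 => if i.val + j.val + 1 = 2 then (1 : L) else 0)).Local v ×
      (cmDatum L 1 (Matrix.of fun i j : Fin 1 => if i.val + j.val + 1 = 1 then (1 : L) else 0)).Local v) ⧸ Subgroup.centralizer ({a} : Set ((cmDatum L 2 (Matrix.of fun i j : Fin 2 => if i.val + j.val + 1 = 2 then (1 : L) else 0)).Local v ×
      (cmDatum L 1 (Matrix.of fun i j : Fin 1 => if i.val + j.val + 1 = 1 then (1 : L) else 0)).Local v)))]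
    [∀ a : ((cmDatum L 2 (Matrix.of fun i j : Fin 2 => if i.val + j.val + 1 = 2 then (1 : L) else 0)).Local v ×
      (cmDatum L 1 (Matrix.of fun i j : Fin 1 => if i.val + j.val + 1 = 1 then (1 : L) else 0)).Local v),
      BorelSpace (((cmDatum L 2 (Matrix.of fun i j : Fin 2 => if i.val + j.val + 1 = 2 then (1 : L) else 0)).Local v ×
      (cmDatum L 1 (Matrix.of fun i j : Fin 1 => if i.val + j.val + 1 = 1 then (1 : L) else 0)).Local v) ⧸ Subgroup.centralizer ({a} : Set ((cmDatum L 2 (Matrix.of fun i j : Fin 2 => if i.val + j.val + 1 = 2 then (1 : L) else 0)).Local v ×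
      (cmDatum L 1 (Matrix.of fun i j : Fin 1 => if i.val + j.val + 1 = 1 then (1 : L) else 0)).Local v)))]
    (νH : Measure ((cmDatum L 2 (Matrix.of fun i j : Fin 2 => if i.val + j.val + 1 = 2 then (1 : L) else 0)).Local v ×
      (cmDatum L 1 (Matrix.of fun i j : Fin 1 => if i.val + j.val + 1 = 1 then (1 : L) else 0)).Local v)) [νH.IsHaarMeasure] [νH.IsMulRightInvariant]
    (νG : Measure ((cmDatum L 3 H').Local v)) [νG.IsHaarMeasure] [νG.IsMulRightInvariant]
    {mH : OrbitalMeasureFamily ((cmDatum L 2 (Matrix.of fun i j : Fin 2 => if i.val + j.val + 1 = 2 then (1 : L) else 0)).Local v ×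
      (cmDatum L 1 (Matrix.of fun i j : Fin 1 => if i.val + j.val + 1 = 1 then (1 : L) else 0)).Local v)} {mG : OrbitalMeasureFamily ((cmDatum L 3 H').Local v)}
    (hmH : mH.IsCanonical (IsLocalGRegular L v) νH)
    (hmG : mG.IsCanonical (fun γ => IsRegularElt (γ.val : GL (Fin 3) (UnitaryGroup.LocalRing L v))) νG)
    -- the piece: Borel, `Ad K′`-invariant, LEFT-INVARIANT under the `v`-level-1 congruence set `K(ϖ_v)` (END fold v6 `stub_levelOneRowsRam` :118 token `hg1` VERBATIM)
    (g : ((cmDatum L 3 H').Local v) → ℂ) (hgm : Measurable g)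
    (hginv : ∀ u ∈ cmLocalIntegralLevel L 3 H' v, ∀ x, g (u * x * u⁻¹) = g x)
    (hg1 : ∀ u : (cmDatum L 3 H').Local v,
      (∀ a b, Valued.v (((toPlace v w (HeckeCharacter.uniformizer ↥(maximalRealSubfield L) v : v.adicCompletion ↥(maximalRealSubfield L))) ^ 1)⁻¹ *
        ((((localNonsplitEquiv (IsCMField.complexConj L) H' (IsCMField.complexConj_ne_one L) w hw u :
            ↥(unitaryGroupOfForm (galAdicCompletionMap (L := L) (IsCMField.complexConj L) hw) (placeForm H' w.1))) : GL (Fin 3) (w.1.adicCompletion L)) :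
              Matrix (Fin 3) (Fin 3) (w.1.adicCompletion L)) a b - (1 : Matrix (Fin 3) (Fin 3) (w.1.adicCompletion L)) a b)) ≤ 1) →
      ∀ x, g (u * x) = g x)
    (X a₀ a₁ ε : ℂ)
    -- SOCKET (the `𝔭`-layer strata enter ONLY here): the `N ∩ K₃`-integral of `g` through every level frame with integral matrix reading, any Haar `μ_N`
    (hN : ∀ [MeasurableSpace ↥(unitaryGroupOfForm (conjLocal L (IsCMField.complexConj L) v) (cmLocalForm L 3 v))] [BorelSpace ↥(unitaryGroupOfForm (conjLocal L (IsCMField.complexConj L) v) (cmLocalForm L 3 v))]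
      (ψ : (cmDatum L 3 H').Local v ≃ₜ* ↥(unitaryGroupOfForm (conjLocal L (IsCMField.complexConj L) v) (cmLocalForm L 3 v)))
      (_hψK : ∀ g : (cmDatum L 3 H').Local v, ψ g ∈ cmLocalIntegralLevel L 3 (Matrix.of fun i j : Fin 3 => if i.val + j.val + 1 = 3 then (1 : L) else 0) v ↔ g ∈ cmLocalIntegralLevel L 3 H' v)
      (_hψc : ∀ g : (cmDatum L 3 H').Local v, IsConj (g.val : GL (Fin 3) (LocalRing L v)) ((ψ g : ↥(unitaryGroupOfForm (conjLocal L (IsCMField.complexConj L) v) (cmLocalForm L 3 v))) : GL (Fin 3) (LocalRing L v)))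
      (T : GL (Fin 3) (w.1.adicCompletion L)) (_hT : T ∈ glInt 3 (w.1.adicCompletion L))
      (_hψT : ∀ g : (cmDatum L 3 H').Local v, localGLPiEquiv L 3 v (((ψ g : ↥(unitaryGroupOfForm (conjLocal L (IsCMField.complexConj L) v) (cmLocalForm L 3 v)))) : GL (Fin 3) (LocalRing L v)) w =
        T * localGLPiEquiv L 3 v (g.val : GL (Fin 3) (LocalRing L v)) w * T⁻¹)
      (μN : Measure ↥(unipotentU (conjLocal L (IsCMField.complexConj L) v) (cmLocalForm L 3 v))) [μN.IsHaarMeasure],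
      ∫ n, g (ψ.symm (n : ↥(unitaryGroupOfForm (conjLocal L (IsCMField.complexConj L) v) (cmLocalForm L 3 v)))) ∂μN =
        (μN.real {n : ↥(unipotentU (conjLocal L (IsCMField.complexConj L) v) (cmLocalForm L 3 v)) |
            (n : ↥(unitaryGroupOfForm (conjLocal L (IsCMField.complexConj L) v) (cmLocalForm L 3 v))) ∈
              cmLocalIntegralLevel L 3 (Matrix.of fun i j : Fin 3 => if i.val + j.val + 1 = 3 then (1 : L) else 0) v} : ℂ) * X)
    -- SOCKET C-Δram: the LEVI VALUE of Rogawski's explicit factor near `1`, `Δ‴_v(γ₁, γ₀) = ε·‖a − 1‖` (binders = ★ T5-Levi `finExplicitDelta_eq_unitModulusChar_of_levi_of_nonsplit`'s)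
    (hΔ : ∃ VΔ ∈ 𝓝 (1 : ((cmDatum L 2 (Matrix.of fun i j : Fin 2 => if i.val + j.val + 1 = 2 then (1 : L) else 0)).Local v ×
        (cmDatum L 1 (Matrix.of fun i j : Fin 1 => if i.val + j.val + 1 = 1 then (1 : L) else 0)).Local v)),
      ∀ γH ∈ VΔ, ∀ (y : ((cmDatum L 2 (Matrix.of fun i j : Fin 2 => if i.val + j.val + 1 = 2 then (1 : L) else 0)).Local v ×
        (cmDatum L 1 (Matrix.of fun i j : Fin 1 => if i.val + j.val + 1 = 1 then (1 : L) else 0)).Local v)) (d : Fin 3 → (UnitaryGroup.LocalRing L v)ˣ),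
        ((endoEmbLocal L v (y * γH * y⁻¹)).val : GL (Fin 3) (UnitaryGroup.LocalRing L v)) = glDiagonal 3 (UnitaryGroup.LocalRing L v) d →
        (∀ i j, i ≠ j → IsUnit ((d i : UnitaryGroup.LocalRing L v) - d j)) →
        endoEmbLocal L v (y * γH * y⁻¹) ∈ cmLocalIntegralLevel L 3 (Matrix.of fun i j : Fin 3 => if i.val + j.val + 1 = 3 then (1 : L) else 0) v →
        ∀ (ha : IsUnit ((((d 0)⁻¹ * d 1 : (UnitaryGroup.LocalRing L v)ˣ) : UnitaryGroup.LocalRing L v) - 1)) (γ₀ : (cmDatum L 3 H').Local v),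
          IsLocalNormPair L H' v (y * γH * y⁻¹) γ₀ →
          finExplicitDelta L v H' (y * γH * y⁻¹) μ γ₀ = ε * (((unitModulusChar (UnitaryGroup.LocalRing L v) ha.unit : ℝ≥0) : ℝ) : ℂ))
    -- the coefficient test (only `a₀` is tested on the Levi population at a ramified place: the `χ₁`-row vanishes, ★ p846841); `X` = the `N ∩ K₃`-average of `g∘ψ⁻¹`
    (ha : a₀ * (νH.real (((cmLocalIntegralLevel L 2 (Matrix.of fun i j : Fin 2 => if i.val + j.val + 1 = 2 then (1 : L) else 0) v).prod
                (cmLocalIntegralLevel L 1 (Matrix.of fun i j : Fin 1 => if i.val + j.val + 1 = 1 then (1 : L) else 0) v) : Subgroup _) : Set _) : ℂ) =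
      ε * (νG.real (cmLocalIntegralLevel L 3 H' v : Set ((cmDatum L 3 H').Local v)) : ℂ) * X) :
        ∃ V ∈ 𝓝 (1 : ((cmDatum L 2 (Matrix.of fun i j : Fin 2 => if i.val + j.val + 1 = 2 then (1 : L) else 0)).Local v ×
        (cmDatum L 1 (Matrix.of fun i j : Fin 1 => if i.val + j.val + 1 = 1 then (1 : L) else 0)).Local v)),
      ∀ γH ∈ V, IsLocalGRegular L v γH →
        (∃ (y : ((cmDatum L 2 (Matrix.of fun i j : Fin 2 => if i.val + j.val + 1 = 2 then (1 : L) else 0)).Local v ×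
        (cmDatum L 1 (Matrix.of fun i j : Fin 1 => if i.val + j.val + 1 = 1 then (1 : L) else 0)).Local v)) (d' : Fin 2 → (UnitaryGroup.LocalRing L v)ˣ),
          glDiagonal 2 (UnitaryGroup.LocalRing L v) d' = ((y * γH * y⁻¹).1.val : GL (Fin 2) (UnitaryGroup.LocalRing L v))) →
        ∑ᶠ cG : ConjClasses ((cmDatum L 3 H').Local v),
            ((finExplicitCollection L H' μ (finExplicitDelta_conj_left_all L H' μ) (finExplicitDelta_conj_right_all L H' μ)) v).Δ γH (Quotient.out cG) *
              classOrbitalIntegral mG g cG =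
          a₀ * stableOrbitalIntegralRel (IsLocalStablyConjH L v) mH
                ((((cmLocalIntegralLevel L 2 (Matrix.of fun i j : Fin 2 => if i.val + j.val + 1 = 2 then (1 : L) else 0) v).prod
                (cmLocalIntegralLevel L 1 (Matrix.of fun i j : Fin 1 => if i.val + j.val + 1 = 1 then (1 : L) else 0) v) : Subgroup _) : Set _).indicator
              (fun h => if (redMat (((h.1.val : GL (Fin 2) (UnitaryGroup.LocalRing L v)).val.map (Pi.evalRingHom (fun w' : PlacesOver L v => w'.1.adicCompletion L) w))) - 1) ^ 2 = 0 ∧ (redMat (((h.1.val : GL (Fin 2) (UnitaryGroup.LocalRing L v)).val.map (Pi.evalRingHom (fun w' : PlacesOver L v => w'.1.adicCompletion L) w))) - 1).rank = 0 then (1 : ℂ) else 0)) γH +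
          a₁ * stableOrbitalIntegralRel (IsLocalStablyConjH L v) mH
                ((((cmLocalIntegralLevel L 2 (Matrix.of fun i j : Fin 2 => if i.val + j.val + 1 = 2 then (1 : L) else 0) v).prod
                (cmLocalIntegralLevel L 1 (Matrix.of fun i j : Fin 1 => if i.val + j.val + 1 = 1 then (1 : L) else 0) v) : Subgroup _) : Set _).indicator
              (fun h => if (redMat (((h.1.val : GL (Fin 2) (UnitaryGroup.LocalRing L v)).val.map (Pi.evalRingHom (fun w' : PlacesOver L v => w'.1.adicCompletion L) w))) - 1) ^ 2 = 0 ∧ (redMat (((h.1.val : GL (Fin 2) (UnitaryGroup.LocalRing L v)).val.map (Pi.evalRingHom (fun w' : PlacesOver L v => w'.1.adicCompletion L) w))) - 1).rank = 1 then (1 : ℂ) else 0)) γH := by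
  have hcne := IsCMField.complexConj_ne_one L
  haveI : Algebra.IsQuadraticExtension ↥(maximalRealSubfield L) L := IsCMField.isQuadraticExtension L
  have hH'c : (H'.map (IsCMField.complexConj L))ᵀ = H' := hH'
  have hH'd : IsUnit H'.det := by
    have h := (Matrix.isUnit_iff_isUnit_det _).1 hH'w
    rw [show placeForm H' w.1 = (algebraMap L (w.1.adicCompletion L)).mapMatrix H' from rfl, ← RingHom.map_det] at h
    exact isUnit_iff_ne_zero.2 fun h0 => h.ne_zero (by rw [h0, map_zero])
  -- `|ι_w ϖ_v|_w = exp(−2)` at the ramified `w`: level-deep = 2-deep, supplied near `1` by ★ (O1″)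
  have hιϖ := (valued_toPlace_uniformizer_of_ramified L (IsCMField.complexConj L) hcne w hw he).1
  have hO1 := exists_nhds_one_forall_levi_twoDeep L v w
  obtain ⟨V, hV, hVd⟩ := hO1
  exact finsum_delta_mul_classOrbitalIntegral_eq_of_levi_ramified_of_orbital_eq L H' μ hH' w hw he hH'w _hH'i h2 A hA hframe νH νG hmH hmG g
    (fun d => ∀ k : Fin 3, Valued.v ((((d k : (UnitaryGroup.LocalRing L v)ˣ) : UnitaryGroup.LocalRing L v) w) - 1) ≤
      Valued.v (toPlace v w (HeckeCharacter.uniformizer ↥(maximalRealSubfield L) v : v.adicCompletion ↥(maximalRealSubfield L))))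
    ⟨V, hV, fun γH hγ y d hι k => (hVd γH hγ y d hι k).trans_eq hιϖ.symm⟩
    (fun _ hd k => valued_lt_one_of_le_exp_neg_two ((hd k).trans_eq hιϖ)) X a₀ a₁ ε
    (by
      intro _ _ ψ hψK hψc T hT hψT μN _ t d hd hreg ha' hb' hdp γ₀ hγ₀
      exact classOrbitalIntegral_eq_mul_of_level_frame_of_left_invariant L w hw H' hH'c hH'd νG hmG ψ hψK hψc T hT hψT μN t hd hreg ha' hb' hdp hγ₀
        g hgm hginv hg1 X (hN ψ hψK hψc T hT hψT μN))
    hΔ ha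

end Literature.NumberTheory.Rogawski1990

end
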